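import Summits.QuantumFields.YangMills.Theorems.BalabanUVNodesN22WindowOfLocalizedSumAtSlots
import Literature.MathematicalPhysics.QuantumFieldTheory.Dimock2015.AnalyticLipschitz

/-!
# BalabanUVNodes ∕ node N22 = NE9 — W1's `YoungLipschitz` SLOT (the DIFFERENCED (2.38), NOT PRINTED) FROM PRINT's *"(or analytic)"*
# AT ACTIVITY LEVEL: coordinatewise holomorphy of the step activities `H(Z; g₀,…,g_k; (𝐔,𝐉))` in the young couplings under the
# (2.38) majorant on a complex margin ⟹ BOTH W1 slots `Bound238` and `YoungLipschitz` (Cauchy on the margin + telescoping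
# through coordinate hybrids); junction BY NAME into the kernel road's engine (J30 §1)

Cell `pub-ymgap`, HUMAN RULING D-0062 (Track A), R134 seat `pub-ymgap-dag-n22-c` (strategy s1: «the history-Lipschitz estimate (2.40)–(2.41) p. 21
of [II] on the W1 object»), generation 12, module J31.  THEOREMS ONLY (no `def`, no `def … : Prop`, no `sorry`); imports this lane's J30
`…Theorems.BalabanUVNodesN22WindowOfLocalizedSumAtSlots` (p599490 ∕ v1.1 p602155; through it node00-def-W1's OBJECT `Node00.HistoryTermsOfRecord`
p455641 with the predicates `ClusterStep.Bound238 ∕ YoungLipschitz`, and Road 1's engine) and the PUBLISHED Cauchy mechanism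
`Literature.….Dimock2015.AnalyticLipschitz` (`real_param_lipschitz`: «analyticity + a sup bound ⟹ Lipschitz in a real parameter», [Dimock2015] §7 ∕
[DimockYuan2024GNFlow] proof of Thm 4) BY NAME.  Filed `--supports stmt-QuantumFields-20544` (K3⁷ `SpineGivenEndpointR13SepCoPH`) as a HELPER.

WHY.  In kernel currency (plan g81 ruling (β)) node N22 is fed, per `(K, k, X)`, by the soft windowed bounds of J29∕J30 whose ACTIVITY-LEVEL located
inputs are W1's two slots on the space tables — `Bound238 S Wk sp A R` ([II] Lemma 3 (2.38) p. 20, node N10's T-row) and `YoungLipschitz S Wk sp ℓ R`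
(the DIFFERENCED (2.38): NOT PRINTED; dag-n22-e's `…N22AtRateRecord13CoPHFixed` §3 and this lane's `…N22W1YoungLipschitz` consume the same slot; «no
producer in the tree»).  Print offers instead ANALYTICITY in the couplings: [I] p. 263 «It is a C^∞-function of g_{j−1} ∈ [0, γ], (or analytic)», p. 266
«the functions E^{(j)}, β_j are analytic functions of the effective coupling constants».  The Cauchy bridge «coordinate-disc analyticity + sup bound ⟹
Lipschitz moduli `4M∕r`» is typed in the tree at TERM level only (`T4CouplingAnalyticity.ne9_of_couplingAnalytic`, this seat's g2 `…N22W1StripNE9`,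
dag-n22-d's `…N22LastCouplingHolo`).  THIS MODULE types it at ACTIVITY level, in W1's prefix currency, so that ONE displayed datum — «(2.38) ON THE
YOUNG-COUPLING MARGIN»: for every prefix `g` of the box, polymer `Z`, configuration `φ ∈ sp Z` and coordinate `i ≤ k`, a holomorphic extension of
`t ↦ H(Z; g|g_i := t; φ)` to a set containing the closed `ρ_i`-discs about the `i`-th coupling interval, bounded there by `A·e^{−R d_{k+1}(Z)}` —
yields BOTH slots: `Bound238 … A R` (evaluation at the real point) and `YoungLipschitz … (4A∕ρ_i)_i R` (Cauchy + telescoping).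

VERTEX-AWARENESS (honest label, `T4CouplingAnalyticity` (L5)∕[H-dil], the cell's vertex verdict pv10).  In the printed scheme the LAST coupling `g_k` is a
dilation parameter of the step-`k` integration variables, so a `g`-INDEPENDENT margin in the last coordinate is available only on coupling intervals
kept OFF the vertex (or in a weighted edition).  Accordingly §3 is typed for GENERAL per-coordinate intervals `I i` (order-connected; e.g. `I k := [γ₀, γ]`
with margin `c·γ₀`, older coordinates `]0, γ]`), and §3's `youngLipschitz_of_coordLipschitz` accepts a displayed Lipschitz letter in any coordinate
where no margin is claimed (MIXED use: older coordinates by Cauchy, the last by a letter of node N09's `EHoloAt` ∕ vertex lineage).  The box edition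
(`I i := ]0, γ]` for all `i`) is the literal producer of the slot consumed by J30 and by dag-n22-e — its last-coordinate margin is a HYPOTHESIS
displayed as such, asserted nowhere.

WHAT (all [folklore] unless cited; 0 `def`, 0 `sorry`).
* §1 `norm_sub_le_sum_of_coordLipschitz` — GENERIC: per-coordinate Lipschitz letters `‖f g − f (g|g_i := t)‖ ≤ ℓ_i|g_i − t|` on a product box
  `{g : Fin n → ℝ | ∀ i, g i ∈ I i}` ⟹ `‖f g − f g′‖ ≤ Σ_i ℓ_i|g_i − g′_i|` (telescoping through the `Finset.piecewise` hybrids, which stay in the box).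
* §2 `norm_sub_update_le_of_coordHolo` — ONE REAL COUPLING on an order-connected interval `I` with margin `ρ`: a holomorphic extension on `O ⊇` the
  closed `ρ`-discs about `I` with `‖·‖ ≤ B` on `O` ⟹ `‖f g − f (g|g_i := t)‖ ≤ (4B∕ρ)|g_i − t|` (`Dimock2015.real_param_lipschitz` BY NAME on
  `[min(g_i,t), max(g_i,t)] ⊆ I`).
* §3 W1 INSTANCES for a one-step cluster datum `S : W1.ClusterStep P 𝔸 M k`: `youngLipschitz_of_coordLipschitz` (§1 at `f := H(Z; ·; φ)` with the
  decay factored: displayed per-coordinate letters ⟹ `S.YoungLipschitz {g | ∀ i, g i ∈ I i} sp ℓ R`); `bound238_of_coordHolo` and ★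
  `youngLipschitz_of_coordHolo` (the margin datum ⟹ `S.Bound238 {…} sp A R` and `S.YoungLipschitz {…} sp (fun i ↦ 4A∕ρ i) R`); the BOX editions
  `bound238_box_of_coordHolo` ∕ ★ `youngLipschitz_box_of_coordHolo` (`I i := ]0, γ]`, `Wk = W1.box γ k` — the slot of record); the FULL-HISTORY
  edition `youngLipschitz_box_of_coordHolo_hist` (datum stated on window histories `g ∈ Window γ` with `S.Hh (g|g_i := t)`, the shape of this
  lane's strip modules; `restrictPrefix_update`).
* §4 JUNCTION BY NAME into the kernel road: `norm_clusterStepE_sub_le_of_coordHolo` — J30 §1 `norm_clusterStepE_sub_le_of_youngLipschitz` with BOTH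
  slots discharged from the ONE margin datum: `‖E^{(k+1)}(X; hist; φ) − E^{(k+1)}(X; hist′; φ)‖ ≤ e^{−κ d_{k+1}(X)}·8e·9·64·K₀²·Σ_i (4A∕ρ_i)|hist_i −
  hist′_i|` on configurations admissible inside `X` — the census rows «Bound238 + YoungLipschitz» of the (β) road collapse to «(2.38) on the
  young-coupling margin» (node N10's Lemma 3 complexified in the couplings; NODE A at the towers of record).
* §5 RIDER (A5): `coordHolo_termlessStep` — the margin datum is satisfiable (termless model step, `Hc ≡ 0`, `O = ℂ`), so §3–§4 are not vacuous
  implications; a MODEL step, not NODE 00's.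

HONEST FRAMING.  Count-neutral helper; by-name Cauchy bridge at the OBJECT.  The margin datum is DISPLAYED (a hypothesis of every theorem here) and
asserted nowhere: for the OLDER couplings it is node N10's T-row (Lemmas 1–3) complexified in the couplings ∕ NODE A's towers of record; for the LAST
coupling print types *"(or analytic)"* only qualitatively and the uniform margin is NOT claimed at the vertex (above).  Nothing of Bałaban's is
constructed; N22 NOT discharged (typed 28∕28 · discharged 5∕27 UNCHANGED); NE9 NOT IN PRINT for d = 4; one finite four-torus programme at fixed ε —
NOT infinite volume, NOT OS on ℝ⁴, NOT a mass gap, NOT Clay.  0 `sorry`, 0 `def`, standard axioms.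

References (TYPES only): [I] = [Balaban1987RG1] T. Bałaban, Commun. Math. Phys. **109** (1987) 249–301 — §0 p. 256 (prefix bookkeeping), §1 p. 263
(«C^∞ … (or analytic)»), §2 p. 266; [II] = [Balaban1988RG2Cluster] T. Bałaban, Commun. Math. Phys. **116** (1988) 1–22 — (2.11)–(2.14) pp. 14–15,
Lemma 3 (2.38) p. 20, (2.39)–(2.41) p. 21; the Cauchy mechanism is [Dimock2015] J. Dimock, arXiv:1512.04373 §7 ∕ [DimockYuan2024GNFlow] proof of
Thm 4, as typed in `Dimock2015.AnalyticLipschitz`.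
-/

noncomputable section

namespace YMDAG.N22.W1

open Set Metric
open scoped BigOperators
open Literature.MathematicalPhysics.QuantumFieldTheory.Balaban1983to89
open Literature.MathematicalPhysics.QuantumFieldTheory.Balaban1983to89.T4Continuum (T4Family)
open Literature.MathematicalPhysics.QuantumFieldTheory.Balaban1983to89.T4OutputRate
open Literature.MathematicalPhysics.QuantumFieldTheory.Balaban1983to89.TreeLengthTorus (torusTreeLen torusTreeLen_nonneg)
open Literature.MathematicalPhysics.QuantumFieldTheory.Balaban1983to89.B12TreeDecay (K₀ K₀_pos)
open Literature.MathematicalPhysics.QuantumFieldTheory.Balaban1983to89.Node00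
open Literature.MathematicalPhysics.QuantumFieldTheory.Balaban1983to89.Node00.Sect2 (domSys domCount CPair)
open Literature.MathematicalPhysics.QuantumFieldTheory.Balaban1983to89.Node00.W1
open Literature.MathematicalPhysics.QuantumFieldTheory.Dimock2015 (real_param_lipschitz)
open YMDAG.N22.WindowOfLocalTerms (norm_clusterStepE_sub_le_of_youngLipschitz)

/-! ## §1 GENERIC: per-coordinate Lipschitz letters on a product box ⟹ the `Σ_i ℓ_i|g_i − g′_i|` bound -/

/-- **TELESCOPING THROUGH COORDINATE HYBRIDS.**  On a product box `{g : Fin n → ℝ | ∀ i, g i ∈ I i}`, per-coordinate Lipschitz letters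
`‖f g − f (g|g_i := t)‖ ≤ ℓ_i·|g_i − t|` (base point in the box, `t ∈ I i`) give `‖f g − f g′‖ ≤ Σ_i ℓ_i·|g_i − g′_i|` for two points of the box:
the hybrids `s.piecewise g′ g` (coordinates of `s` switched to `g′`) stay in the box and consecutive ones differ in one coordinate. [folklore] -/
theorem norm_sub_le_sum_of_coordLipschitz {n : ℕ} {F : Type*} [SeminormedAddCommGroup F] (f : (Fin n → ℝ) → F)
    (I : Fin n → Set ℝ) (ℓ : Fin n → ℝ)
    (h : ∀ g : Fin n → ℝ, (∀ i, g i ∈ I i) → ∀ i, ∀ t ∈ I i, ‖f g - f (Function.update g i t)‖ ≤ ℓ i * |g i - t|)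
    {g g' : Fin n → ℝ} (hg : ∀ i, g i ∈ I i) (hg' : ∀ i, g' i ∈ I i) :
    ‖f g - f g'‖ ≤ ∑ i, ℓ i * |g i - g' i| := by
  classical
  have hmem : ∀ (s : Finset (Fin n)) (i : Fin n), s.piecewise g' g i ∈ I i := by
    intro s i
    by_cases hi : i ∈ s
    · rw [Finset.piecewise_eq_of_mem _ _ _ hi]; exact hg' i
    · rw [Finset.piecewise_eq_of_notMem _ _ _ hi]; exact hg i
  have key : ∀ s : Finset (Fin n), ‖f g - f (s.piecewise g' g)‖ ≤ ∑ i ∈ s, ℓ i * |g i - g' i| := by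
    intro s
    induction s using Finset.induction_on with
    | empty => simp
    | @insert j s hj ih =>
      rw [Finset.piecewise_insert, Finset.sum_insert hj]
      have hstep := h (s.piecewise g' g) (hmem s) j (g' j) (hg' j)
      rw [Finset.piecewise_eq_of_notMem _ _ _ hj] at hstep
      calc ‖f g - f (Function.update (s.piecewise g' g) j (g' j))‖
          ≤ ‖f g - f (s.piecewise g' g)‖ + ‖f (s.piecewise g' g) - f (Function.update (s.piecewise g' g) j (g' j))‖ :=
            norm_sub_le_norm_sub_add_norm_sub _ _ _
        _ ≤ (∑ i ∈ s, ℓ i * |g i - g' i|) + ℓ j * |g j - g' j| := add_le_add ih hstep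
        _ = ℓ j * |g j - g' j| + ∑ i ∈ s, ℓ i * |g i - g' i| := add_comm _ _
  simpa only [Finset.piecewise_univ] using key Finset.univ

/-! ## §2 ONE REAL COUPLING: holomorphic extension on a margin with a sup bound ⟹ Lipschitz in that coupling (Cauchy, by name) -/

/-- **CAUCHY ON THE MARGIN OF ONE COUPLING INTERVAL.**  `I ⊆ ℝ` order-connected, margin `ρ > 0`; a base point `g` with `g_i ∈ I`; a function `Fc`
holomorphic on `O ⊇` the closed `ρ`-discs about the points of `I`, `‖Fc‖ ≤ B` on `O`, agreeing with `t ↦ f (g|g_i := t)` on `I`: then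
`‖f g − f (g|g_i := t)‖ ≤ (4B∕ρ)·|g_i − t|` for `t ∈ I` — `Dimock2015.real_param_lipschitz` on the segment `[min(g_i,t), max(g_i,t)] ⊆ I`.
[cite: DimockYuan2024GNFlow, proof of Thm 4 (arXiv:2303.07916v3 TeX ll. 4073-4076)] -/
theorem norm_sub_update_le_of_coordHolo {n : ℕ} {F : Type*} [NormedAddCommGroup F] [NormedSpace ℂ F] [CompleteSpace F]
    (f : (Fin n → ℝ) → F) {I : Set ℝ} (hI : I.OrdConnected) {ρ B : ℝ} (hρ : 0 < ρ) (g : Fin n → ℝ) (i : Fin n)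
    (hgi : g i ∈ I) (Fc : ℂ → F) (O : Set ℂ) (hhol : DifferentiableOn ℂ Fc O) (hdisc : ∀ t ∈ I, closedBall (t : ℂ) ρ ⊆ O)
    (hB : ∀ z ∈ O, ‖Fc z‖ ≤ B) (hrep : ∀ t ∈ I, Fc t = f (Function.update g i t)) {t : ℝ} (ht : t ∈ I) :
    ‖f g - f (Function.update g i t)‖ ≤ 4 * B / ρ * |g i - t| := by
  have hseg : Icc (min (g i) t) (max (g i) t) ⊆ I := hI.uIcc_subset hgi ht
  have key := real_param_lipschitz (a := min (g i) t) (b := max (g i) t) hρ hhol hB (fun s hs => hdisc s (hseg hs))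
    (s := g i) (t := t) ⟨min_le_left _ _, le_max_left _ _⟩ ⟨min_le_right _ _, le_max_right _ _⟩
  rwa [hrep _ hgi, hrep _ ht, Function.update_eq_self] at key

/-! ## §3 W1 INSTANCES: the margin datum ⟹ `Bound238` and `YoungLipschitz` for a one-step cluster datum -/

section W1
variable {P : Params} {𝔸 : Type*} {M k : ℕ}

/-- **DISPLAYED PER-COORDINATE LETTERS ⟹ W1's `YoungLipschitz`** on a product box of young-coupling prefixes (§1 at `f := H(Z; ·; φ)`, the decay
`e^{−R d_{k+1}(Z)}` factored out of the letters).  MIXED use: feed the older coordinates from `norm_sub_update_le_of_coordHolo` and the last one from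
any Lipschitz letter of record. [folklore] -/
theorem youngLipschitz_of_coordLipschitz (S : ClusterStep P 𝔸 M k) (I : Fin (k + 1) → Set ℝ)
    (sp : (domSys P M (k + 1)).Dom → Set (CPair P 𝔸)) (ℓ : Fin (k + 1) → ℝ) (R : ℝ)
    (h : ∀ g : Fin (k + 1) → ℝ, (∀ i, g i ∈ I i) → ∀ Z, ∀ φ ∈ sp Z, ∀ i, ∀ t ∈ I i,
      ‖S.H g φ Z - S.H (Function.update g i t) φ Z‖ ≤ Real.exp (-(R * (domSys P M (k + 1)).dj Z)) * ℓ i * |g i - t|) :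
    S.YoungLipschitz {g | ∀ i, g i ∈ I i} sp ℓ R := by
  intro g hg g' hg' Z φ hφ
  have key := norm_sub_le_sum_of_coordLipschitz (fun g => S.H g φ Z) I
    (fun i => Real.exp (-(R * (domSys P M (k + 1)).dj Z)) * ℓ i) (fun g hg i t ht => h g hg Z φ hφ i t ht) hg hg'
  calc ‖S.H g φ Z - S.H g' φ Z‖ ≤ ∑ i, Real.exp (-(R * (domSys P M (k + 1)).dj Z)) * ℓ i * |g i - g' i| := key
    _ = Real.exp (-(R * (domSys P M (k + 1)).dj Z)) * ∑ i, ℓ i * |g i - g' i| := by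
        rw [Finset.mul_sum]
        exact Finset.sum_congr rfl fun i _ => by ring

/-- **THE MARGIN DATUM ⟹ W1's `Bound238`** (evaluation at the real point `t = g_i`; needs one coordinate, `i = 0`). [cite: Balaban1988RG2Cluster, Lemma 3 (2.38) p.20] -/
theorem bound238_of_coordHolo (S : ClusterStep P 𝔸 M k) (I : Fin (k + 1) → Set ℝ)
    (sp : (domSys P M (k + 1)).Dom → Set (CPair P 𝔸)) {A R : ℝ} (ρ : Fin (k + 1) → ℝ) (hρ : ∀ i, 0 < ρ i)
    (hH : ∀ g : Fin (k + 1) → ℝ, (∀ i, g i ∈ I i) → ∀ Z, ∀ φ ∈ sp Z, ∀ i,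
      ∃ (Hc : ℂ → ℂ) (O : Set ℂ), DifferentiableOn ℂ Hc O ∧ (∀ t ∈ I i, closedBall (t : ℂ) (ρ i) ⊆ O) ∧
        (∀ z ∈ O, ‖Hc z‖ ≤ A * Real.exp (-(R * (domSys P M (k + 1)).dj Z))) ∧
        (∀ t ∈ I i, Hc t = S.H (Function.update g i t) φ Z)) :
    S.Bound238 {g | ∀ i, g i ∈ I i} sp A R := by
  intro g hg Z φ hφ
  obtain ⟨Hc, O, -, hdisc, hB, hrep⟩ := hH g hg Z φ hφ 0
  have h0 : ((g 0 : ℝ) : ℂ) ∈ O := hdisc (g 0) (hg 0) (mem_closedBall_self (hρ 0).le)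
  have e : Hc (g 0) = S.H g φ Z := by rw [hrep _ (hg 0), Function.update_eq_self]
  simpa only [e] using hB _ h0

/-- **★ THE MARGIN DATUM ⟹ W1's `YoungLipschitz` WITH THE CAUCHY TABLE `4A∕ρ_i`** ((2.38) on the young-coupling margin ⟹ the differenced (2.38)):
general order-connected coupling intervals `I i` and radii `ρ i > 0` (vertex-aware: no uniform margin is claimed where `I i` reaches the vertex unless
the caller supplies it). [cite: Balaban1987RG1, §1 p.263 and §2 p.266; Balaban1988RG2Cluster, Lemma 3 (2.38) p.20] -/
theorem youngLipschitz_of_coordHolo (S : ClusterStep P 𝔸 M k) (I : Fin (k + 1) → Set ℝ) (hI : ∀ i, (I i).OrdConnected)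
    (sp : (domSys P M (k + 1)).Dom → Set (CPair P 𝔸)) {A R : ℝ} (ρ : Fin (k + 1) → ℝ) (hρ : ∀ i, 0 < ρ i)
    (hH : ∀ g : Fin (k + 1) → ℝ, (∀ i, g i ∈ I i) → ∀ Z, ∀ φ ∈ sp Z, ∀ i,
      ∃ (Hc : ℂ → ℂ) (O : Set ℂ), DifferentiableOn ℂ Hc O ∧ (∀ t ∈ I i, closedBall (t : ℂ) (ρ i) ⊆ O) ∧
        (∀ z ∈ O, ‖Hc z‖ ≤ A * Real.exp (-(R * (domSys P M (k + 1)).dj Z))) ∧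
        (∀ t ∈ I i, Hc t = S.H (Function.update g i t) φ Z)) :
    S.YoungLipschitz {g | ∀ i, g i ∈ I i} sp (fun i => 4 * A / ρ i) R := by
  refine youngLipschitz_of_coordLipschitz S I sp _ R fun g hg Z φ hφ i t ht => ?_
  obtain ⟨Hc, O, hhol, hdisc, hB, hrep⟩ := hH g hg Z φ hφ i
  have key := norm_sub_update_le_of_coordHolo (fun g => S.H g φ Z) (hI i) (hρ i) g i (hg i) Hc O hhol hdisc hB hrep ht
  calc ‖S.H g φ Z - S.H (Function.update g i t) φ Z‖
      ≤ 4 * (A * Real.exp (-(R * (domSys P M (k + 1)).dj Z))) / ρ i * |g i - t| := key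
    _ = Real.exp (-(R * (domSys P M (k + 1)).dj Z)) * (4 * A / ρ i) * |g i - t| := by ring

/-- The box of young couplings `]0, γ]^{k+1}` IS the product box of the intervals `]0, γ]`. [cite: Balaban1987RG1, Thm 1 p.259 (bookkeeping)] -/
theorem box_eq_setOf_mem_Ioc (γ : ℝ) (k : ℕ) : box γ k = {g : Fin (k + 1) → ℝ | ∀ i, g i ∈ Ioc (0 : ℝ) γ} := rfl

/-- **`Bound238` ON THE BOX OF RECORD** from the margin datum about `]0, γ]`. [cite: Balaban1988RG2Cluster, Lemma 3 (2.38) p.20] -/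
theorem bound238_box_of_coordHolo (S : ClusterStep P 𝔸 M k) {γ : ℝ} (sp : (domSys P M (k + 1)).Dom → Set (CPair P 𝔸)) {A R : ℝ}
    (ρ : Fin (k + 1) → ℝ) (hρ : ∀ i, 0 < ρ i)
    (hH : ∀ g ∈ box γ k, ∀ Z, ∀ φ ∈ sp Z, ∀ i : Fin (k + 1),
      ∃ (Hc : ℂ → ℂ) (O : Set ℂ), DifferentiableOn ℂ Hc O ∧ (∀ t ∈ Ioc (0 : ℝ) γ, closedBall (t : ℂ) (ρ i) ⊆ O) ∧
        (∀ z ∈ O, ‖Hc z‖ ≤ A * Real.exp (-(R * (domSys P M (k + 1)).dj Z))) ∧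
        (∀ t ∈ Ioc (0 : ℝ) γ, Hc t = S.H (Function.update g i t) φ Z)) :
    S.Bound238 (box γ k) sp A R := by
  rw [box_eq_setOf_mem_Ioc]
  exact bound238_of_coordHolo S (fun _ => Ioc (0 : ℝ) γ) sp ρ hρ hH

/-- **★ `YoungLipschitz` ON THE BOX OF RECORD — THE SLOT CONSUMED BY J30 AND BY dag-n22-e's RECORD MODULES** — from the margin datum about `]0, γ]`
in every young coupling, with the Cauchy table `4A∕ρ_i`.  The last-coordinate margin is a displayed hypothesis (vertex-awareness above).
[cite: Balaban1987RG1, §1 p.263 and §2 p.266; Balaban1988RG2Cluster, Lemma 3 (2.38) p.20 and (2.39)-(2.41) p.21] -/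
theorem youngLipschitz_box_of_coordHolo (S : ClusterStep P 𝔸 M k) {γ : ℝ} (sp : (domSys P M (k + 1)).Dom → Set (CPair P 𝔸)) {A R : ℝ}
    (ρ : Fin (k + 1) → ℝ) (hρ : ∀ i, 0 < ρ i)
    (hH : ∀ g ∈ box γ k, ∀ Z, ∀ φ ∈ sp Z, ∀ i : Fin (k + 1),
      ∃ (Hc : ℂ → ℂ) (O : Set ℂ), DifferentiableOn ℂ Hc O ∧ (∀ t ∈ Ioc (0 : ℝ) γ, closedBall (t : ℂ) (ρ i) ⊆ O) ∧
        (∀ z ∈ O, ‖Hc z‖ ≤ A * Real.exp (-(R * (domSys P M (k + 1)).dj Z))) ∧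
        (∀ t ∈ Ioc (0 : ℝ) γ, Hc t = S.H (Function.update g i t) φ Z)) :
    S.YoungLipschitz (box γ k) sp (fun i => 4 * A / ρ i) R := by
  rw [box_eq_setOf_mem_Ioc]
  exact youngLipschitz_of_coordHolo S (fun _ => Ioc (0 : ℝ) γ) (fun _ => Set.ordConnected_Ioc) sp ρ hρ hH

/-- Updating a young coupling of a full history and restricting to the prefix = restricting, then updating. [cite: Balaban1987RG1, §0 p.256 (bookkeeping)] -/
theorem restrictPrefix_update (k : ℕ) (g : ℕ → ℝ) (i : Fin (k + 1)) (t : ℝ) :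
    restrictPrefix k (Function.update g i t) = Function.update (restrictPrefix k g) i t := by
  funext j
  by_cases hj : j = i
  · subst hj
    simp [restrictPrefix]
  · have hj' : (j : ℕ) ≠ (i : ℕ) := fun h => hj (Fin.ext h)
    simp [restrictPrefix, Function.update_of_ne hj, Function.update_of_ne hj']

/-- **FULL-HISTORY EDITION** (the datum in the shape of this lane's strip modules: window histories `g ∈ Window γ`, coupling index `i < k+1`, the
activity `S.Hh (g|g_i := t)` at the full history, ONE radius `ρ₀`): ⟹ `S.YoungLipschitz (box γ k) sp (fun _ ↦ 4A∕ρ₀) R`.  A prefix of the box is the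
restriction of the window history extending it by its own `0`-th coupling. [cite: Balaban1987RG1, §0 p.256 and §1 p.263; Balaban1988RG2Cluster, (2.38) p.20] -/
theorem youngLipschitz_box_of_coordHolo_hist (S : ClusterStep P 𝔸 M k) {γ : ℝ} (sp : (domSys P M (k + 1)).Dom → Set (CPair P 𝔸))
    {A R ρ₀ : ℝ} (hρ₀ : 0 < ρ₀)
    (hH : ∀ g : ℕ → ℝ, g ∈ Window γ → ∀ Z, ∀ φ ∈ sp Z, ∀ i < k + 1,
      ∃ (Hc : ℂ → ℂ) (O : Set ℂ), DifferentiableOn ℂ Hc O ∧ (∀ t ∈ Ioc (0 : ℝ) γ, closedBall (t : ℂ) ρ₀ ⊆ O) ∧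
        (∀ z ∈ O, ‖Hc z‖ ≤ A * Real.exp (-(R * (domSys P M (k + 1)).dj Z))) ∧
        (∀ t ∈ Ioc (0 : ℝ) γ, Hc t = S.Hh (Function.update g i t) φ Z)) :
    S.YoungLipschitz (box γ k) sp (fun _ => 4 * A / ρ₀) R := by
  refine youngLipschitz_box_of_coordHolo S sp (fun _ => ρ₀) (fun _ => hρ₀) fun p hp Z φ hφ i => ?_
  -- extend the prefix `p` to a window history by its own `0`-th coupling
  set g : ℕ → ℝ := fun n => if h : n < k + 1 then p ⟨n, h⟩ else p 0 with hg_def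
  have hgn : ∀ n (hn : n < k + 1), g n = p ⟨n, hn⟩ := fun n hn => by simp only [hg_def, dif_pos hn]
  have hres : restrictPrefix k g = p := by
    funext j
    rw [restrictPrefix_apply, hgn j j.2]
  have hgW : g ∈ Window γ := by
    intro n
    by_cases hn : n < k + 1
    · rw [hgn n hn]
      exact hp ⟨n, hn⟩
    · have e : g n = p 0 := by simp only [hg_def, dif_neg hn]
      rw [e]
      exact hp 0
  obtain ⟨Hc, O, hhol, hdisc, hB, hrep⟩ := hH g hgW Z φ hφ i i.2
  refine ⟨Hc, O, hhol, hdisc, hB, fun t ht => ?_⟩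
  rw [hrep t ht, ClusterStep.Hh, show ((i : ℕ) : ℕ) = ((⟨i, i.2⟩ : Fin (k + 1)) : ℕ) from rfl, restrictPrefix_update, hres]

end W1

/-! ## §4 JUNCTION BY NAME into the kernel road: J30's engine with both slots discharged from the margin datum -/

section Junction
variable (F : T4Family) (K : ℕ) {𝔸 : Type*} {M k : ℕ}

open Classical in
/-- **THE DIFFERENCED (2.39)–(2.41) AT THE (2.13) TERM FROM (2.38) ON THE YOUNG-COUPLING MARGIN.**  J30 §1
`norm_clusterStepE_sub_le_of_youngLipschitz` with `h238 := bound238_box_of_coordHolo` and `hYL := youngLipschitz_box_of_coordHolo`: for two prefixes of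
the box, every `X ∈ 𝐃_{k+1}` of the `K`-th torus and every configuration admissible inside `X`,
`‖E^{(k+1)}(X; hist; φ) − E^{(k+1)}(X; hist′; φ)‖ ≤ e^{−κ d_{k+1}(X)}·8·e·9·64·K₀(64,8)²·Σ_i (4A∕ρ_i)|hist_i − hist′_i|` under Road 1's numerals.
[cite: Balaban1988RG2Cluster, (2.13) p.14, (2.38) p.20 and (2.39)-(2.41) p.21; Balaban1987RG1, §1 p.263] -/
theorem norm_clusterStepE_sub_le_of_coordHolo (S : ClusterStep (F.P K) 𝔸 M k) {γ : ℝ}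
    (sp : (domSys (F.P K) M (k + 1)).Dom → Set (CPair (F.P K) 𝔸)) {A R r₁ κ : ℝ} (ρ : Fin (k + 1) → ℝ) (hρ : ∀ i, 0 < ρ i)
    (hA : 0 < A) (hr₁ : 0 ≤ r₁) (hκ : κ ≤ r₁) (hrate : r₁ + 2 * (64 * Real.log 162) + 2 ≤ R)
    (hsmall : 2 * A * Real.exp (5 * r₁ + 1) * K₀ 64 8 * 9 * 64 ≤ 1)
    (hH : ∀ g ∈ box γ k, ∀ Z, ∀ φ ∈ sp Z, ∀ i : Fin (k + 1),
      ∃ (Hc : ℂ → ℂ) (O : Set ℂ), DifferentiableOn ℂ Hc O ∧ (∀ t ∈ Ioc (0 : ℝ) γ, closedBall (t : ℂ) (ρ i) ⊆ O) ∧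
        (∀ z ∈ O, ‖Hc z‖ ≤ A * Real.exp (-(R * (domSys (F.P K) M (k + 1)).dj Z))) ∧
        (∀ t ∈ Ioc (0 : ℝ) γ, Hc t = S.H (Function.update g i t) φ Z))
    {hist hist' : Fin (k + 1) → ℝ} (hh : hist ∈ box γ k) (hh' : hist' ∈ box γ k) (X : (domSys (F.P K) M (k + 1)).Dom)
    {φ : CPair (F.P K) 𝔸} (hφ : ∀ Z : (domSys (F.P K) M (k + 1)).Dom, Z.1 ⊆ X.1 → φ ∈ sp Z) :
    ‖S.E hist φ X - S.E hist' φ X‖ ≤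
      Real.exp (-(κ * torusTreeLen X.1)) * (8 * (Real.exp 1 * 9 * 64 * K₀ 64 8 ^ 2) * ∑ i, (4 * A / ρ i) * |hist i - hist' i|) :=
  norm_clusterStepE_sub_le_of_youngLipschitz F K S (box γ k) sp (fun i => 4 * A / ρ i) hA hr₁ hκ hrate hsmall
    (fun i => div_nonneg (mul_nonneg (by norm_num) hA.le) (hρ i).le)
    (bound238_box_of_coordHolo S sp ρ hρ hH) (youngLipschitz_box_of_coordHolo S sp ρ hρ hH) hh hh' X hφ

end Junction

/-! ## §5 RIDER (A5): the margin datum is satisfiable -/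

section Rider
variable {P : Params} {𝔸 : Type*} {M k : ℕ}

/-- **NON-VACUITY (A5 rider).**  The termless MODEL step (`idx Z = ∅`, so `H ≡ 0`) carries the margin datum on any intervals with `Hc ≡ 0`,
`O = ℂ`, for every `A ≥ 0` — so §3–§4 are not vacuous implications.  A model step, NOT NODE 00's. [folklore] -/
theorem coordHolo_termlessStep (I : Fin (k + 1) → Set ℝ) (sp : (domSys P M (k + 1)).Dom → Set (CPair P 𝔸)) {A : ℝ} (hA : 0 ≤ A)
    (R : ℝ) (ρ : Fin (k + 1) → ℝ) :
    ∀ g : Fin (k + 1) → ℝ, (∀ i, g i ∈ I i) → ∀ Z, ∀ φ ∈ sp Z, ∀ i,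
      ∃ (Hc : ℂ → ℂ) (O : Set ℂ), DifferentiableOn ℂ Hc O ∧ (∀ t ∈ I i, closedBall (t : ℂ) (ρ i) ⊆ O) ∧
        (∀ z ∈ O, ‖Hc z‖ ≤ A * Real.exp (-(R * (domSys P M (k + 1)).dj Z))) ∧
        (∀ t ∈ I i, Hc t = (⟨PUnit, fun _ => ∅, fun _ _ _ => 0⟩ : ClusterStep P 𝔸 M k).H (Function.update g i t) φ Z) := by
  intro g _ Z φ _ i
  refine ⟨fun _ => 0, univ, differentiableOn_const 0, fun _ _ => subset_univ _, fun z _ => ?_, fun t _ => ?_⟩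
  · simp only [norm_zero]
    positivity
  · simp [ClusterStep.H]

end Rider

end YMDAG.N22.W1

end
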